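import Literature.Computability.Cryptography.PeriodisedFourierTransform
import HarnessLib

/-!
# The eigenmodes of the cyclic shift and phase kick-back (Kitaev 1995, §5)

Topic `Literature/Computability/Cryptography`; support for the discharge of
`VanDamSeroussi2002_gaussSumPhase_qsolvable`. Kitaev 1995, §5: "the Fourier transform on the group
`ℤ_q` … can be represented as an eigenvalue measurement" of the cyclic shift `V : |x⟩ ↦ |x + 1⟩`,
whose eigenvectors are the Fourier modes `|ψ_u⟩ = q^{-1/2} Σ_x e(−ux/q)|x⟩` with eigenvalues
`e(u/q)`; and (§2.2 with §3) a register prepared in a mode picks up the PHASE `e(ub/q)` when `b` is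
added to it — the kick-back by which the tree's van Dam–Seroussi circuit imprints the character
values `χ(y)` (van Dam–Seroussi 2002, §3 Lemma 1) without any non-Clifford rotation gate: the mode
index `u` is LEARNED by Kitaev's eigenvalue measurement, and the addend `b = ⌊p·θ⌉ · u⁻¹ mod p` is a
classical (oracle) computation. In the function form of `PeriodisedFourierTransform.lean`
(amplitudes `ℕ → ℂ` read on `range`), for a modulus `M > 0` inside a register of `K ≥ M` values:

* `Kitaev.mode M u x = [x < M] M^{-1/2} e(−ux/M)` and its algebra: `sum_conj_mode_mul_mode`
  (orthonormality), **`ite_zero_eq_sum_mode`** (`|0⟩ = M^{-1/2} Σ_u |ψ_u⟩`: the clean register is the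
  uniform superposition of ALL modes), **`mode_shift`** (`ψ_u((x − b) mod M) = e(ub/M) ψ_u(x)`: adding
  `b` to a register in mode `u` multiplies it by `e(ub/M)`), `mode_succ` (the eigenvalue `e(u/M)`);
* `Kitaev.modeCoeff M u f = M^{-1/2} Σ_{z<M} f(z) e(uz/M)` and **`sum_modeCoeff_mul_mode`** (Fourier
  inversion on `ℤ_M`: `f(x) = Σ_u modeCoeff_u(f) ψ_u(x)` for `x < M`);
* **`modeCoeff_rep_eq_repFT`** — for the `R`-fold repetition `R^{-1/2} Σ_{j<R} |y + jp⟩` of a basis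
  state (`Rp ≤ M`) the mode coefficients ARE Hales's transformed repetition `Hales2002.repFT p R M y u`:
  measuring the shift's eigenvalue on that register is measuring it in the Fourier basis, with the
  amplitudes analysed in `PeriodisedFourierTransform.lean`.

Everything is proved; the two definitions have bodies; no named fact.

## References

* A. Yu. Kitaev, *Quantum measurements and the Abelian Stabilizer Problem*, arXiv:quant-ph/9511026
  (1995), §5 (the Fourier transform as an eigenvalue measurement of the shift), §3 (eigenvalue
  measurement), §2.2 [Kitaev1995].
* W. van Dam, G. Seroussi, arXiv:quant-ph/0207131 (2002), §3 Lemma 1, §4 Algorithm 1 [VanDamSeroussi2002].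
* L. Hales, PhD thesis, UC Berkeley 2002 (arXiv:quant-ph/0212002), Ch. 5 §1 [Hales2002].
-/

noncomputable section

open Finset Real Complex

namespace Literature.Computability.Cryptography

namespace Kitaev

open Hales2002

/-! ### The modes -/

/-- **The Fourier mode `u` of `ℤ_M`** inside a register: `ψ_u(x) = M^{-1/2} e(−ux/M)` for `x < M`,
`0` beyond. [cite: Kitaev1995, §5 (eigenvectors of the cyclic shift)] -/
def mode (M u x : ℕ) : ℂ := if x < M then (((Real.sqrt M)⁻¹ : ℝ) : ℂ) * e (-((u * x : ℕ) : ℝ) / M) else 0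

/-- Modes vanish beyond the modulus. [folklore] -/
theorem mode_of_le {M u x : ℕ} (h : M ≤ x) : mode M u x = 0 := by
  rw [mode, if_neg (not_lt.2 h)]

/-- The value of a mode below the modulus. [folklore] -/
theorem mode_of_lt {M u x : ℕ} (h : x < M) : mode M u x = (((Real.sqrt M)⁻¹ : ℝ) : ℂ) * e (-((u * x : ℕ) : ℝ) / M) := by
  rw [mode, if_pos h]

/-- Modes are bounded by `M^{-1/2}`. [folklore] -/
theorem norm_mode_le (M u x : ℕ) : ‖mode M u x‖ ≤ (Real.sqrt M)⁻¹ := by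
  unfold mode
  split_ifs
  · rw [norm_mul, norm_e, mul_one, Complex.norm_real, Real.norm_of_nonneg (inv_nonneg.2 (Real.sqrt_nonneg _))]
  · rw [norm_zero]; exact inv_nonneg.2 (Real.sqrt_nonneg _)

/-- The conjugate of a mode below the modulus. [folklore] -/
theorem conj_mode_of_lt {M u x : ℕ} (h : x < M) :
    (starRingEnd ℂ) (mode M u x) = (((Real.sqrt M)⁻¹ : ℝ) : ℂ) * e (((u * x : ℕ) : ℝ) / M) := by
  rw [mode_of_lt h, map_mul, Complex.conj_ofReal, e_def, e_def, ← Circle.coe_inv_eq_conj, ← AddChar.map_neg_eq_inv]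
  congr 2
  ring

/-- `Σ_{u<M} e(u m/M)` for an integer `m`: `M [M ∣ m]` (`sum_range_e_div` with the factors commuted). [folklore] -/
theorem sum_range_e_mul_div (M : ℕ) (hM : 0 < M) (m : ℤ) :
    ∑ u ∈ range M, e ((m : ℝ) * u / M) = if (M : ℤ) ∣ m then (M : ℂ) else 0 := by
  rw [← sum_range_e_div M hM m]
  exact sum_congr rfl fun u _ => by rw [mul_comm]

/-- **Orthonormality of the modes** (read on any window `[0, K)`, `K ≥ M`): `⟨ψ_u, ψ_{u'}⟩ = [u = u']`
for `u, u' < M`. [cite: Kitaev1995, §5] -/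
theorem sum_conj_mode_mul_mode {M K : ℕ} (hM : 0 < M) (hK : M ≤ K) {u u' : ℕ} (hu : u < M) (hu' : u' < M) :
    ∑ x ∈ range K, (starRingEnd ℂ) (mode M u x) * mode M u' x = if u = u' then 1 else 0 := by
  have hMr : (0 : ℝ) < M := by exact_mod_cast hM
  -- restrict to `x < M`
  rw [← sum_range_add_sum_Ico _ hK, sum_eq_zero (s := Ico M K) (fun x hx => by
    rw [mode_of_le (u := u') (mem_Ico.1 hx).1, mul_zero]), add_zero]
  have hterm : ∀ x ∈ range M, (starRingEnd ℂ) (mode M u x) * mode M u' x =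
      ((M : ℂ))⁻¹ * e ((((u : ℤ) - u' : ℤ) : ℝ) * x / M) := by
    intro x hx
    have hx' := mem_range.1 hx
    rw [conj_mode_of_lt hx', mode_of_lt hx']
    have hs : ((((Real.sqrt M)⁻¹ : ℝ) : ℂ)) * (((Real.sqrt M)⁻¹ : ℝ) : ℂ) = ((M : ℂ))⁻¹ := by
      rw [← Complex.ofReal_mul, ← mul_inv, Real.mul_self_sqrt hMr.le]; push_cast; rfl
    calc (((Real.sqrt M)⁻¹ : ℝ) : ℂ) * e (((u * x : ℕ) : ℝ) / M) * ((((Real.sqrt M)⁻¹ : ℝ) : ℂ) * e (-((u' * x : ℕ) : ℝ) / M))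
        = ((((Real.sqrt M)⁻¹ : ℝ) : ℂ)) * (((Real.sqrt M)⁻¹ : ℝ) : ℂ) * (e (((u * x : ℕ) : ℝ) / M) * e (-((u' * x : ℕ) : ℝ) / M)) := by ring
      _ = ((M : ℂ))⁻¹ * e ((((u : ℤ) - u' : ℤ) : ℝ) * x / M) := by
        rw [hs, ← e_add]; congr 2; push_cast; ring
  rw [sum_congr rfl hterm, ← mul_sum, sum_range_e_mul_div M hM]
  by_cases h : u = u'
  · subst h
    rw [if_pos (by simp), if_pos rfl, inv_mul_cancel₀ (by exact_mod_cast hM.ne')]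
  · rw [if_neg, mul_zero, if_neg h]
    intro hd
    have h1 : |((u : ℤ) - u')| < M := by rw [abs_lt]; constructor <;> omega
    have h2 := Int.eq_zero_of_abs_lt_dvd hd h1
    omega

/-- **The clean register is the uniform superposition of all modes**: `[x = 0] = M^{-1/2} Σ_{u<M} ψ_u(x)`
(both sides vanish for `x ≥ M > 0`). [cite: Kitaev1995, §4 (p. 15: |a⟩ = q^{-1/2} Σ_h |ψ_h⟩)] -/
theorem ite_zero_eq_sum_mode {M : ℕ} (hM : 0 < M) (x : ℕ) :
    (if x = 0 then (1 : ℂ) else 0) = (((Real.sqrt M)⁻¹ : ℝ) : ℂ) * ∑ u ∈ range M, mode M u x := by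
  have hMr : (0 : ℝ) < M := by exact_mod_cast hM
  by_cases hx : x < M
  · have hterm : ∀ u ∈ range M, mode M u x = (((Real.sqrt M)⁻¹ : ℝ) : ℂ) * e (((-(x : ℤ) : ℤ) : ℝ) * u / M) := by
      intro u _
      rw [mode_of_lt hx]; congr 2; push_cast; ring
    rw [sum_congr rfl hterm, ← mul_sum, sum_range_e_mul_div M hM, ← mul_assoc, ← Complex.ofReal_mul, ← mul_inv,
      Real.mul_self_sqrt hMr.le]
    by_cases h0 : x = 0
    · subst h0
      rw [if_pos rfl, if_pos (by simp)]; push_cast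
      rw [inv_mul_cancel₀ (by exact_mod_cast hM.ne')]
    · rw [if_neg h0, if_neg, mul_zero]
      intro hd
      have h1 : |(-(x : ℤ))| < M := by rw [abs_neg, Nat.abs_cast]; exact_mod_cast hx
      have := Int.eq_zero_of_abs_lt_dvd hd h1
      omega
  · rw [if_neg (by omega), sum_eq_zero (fun u _ => mode_of_le (not_lt.1 hx)), mul_zero]

/-- **The shift is diagonal on the modes**: `ψ_u((x + M − b mod M) mod M) = e(ub/M) ψ_u(x)` for `x < M` —
adding `b` (mod `M`) to a register in mode `u` multiplies the state by `e(ub/M)` (phase kick-back).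
[cite: Kitaev1995, §5 (V|ψ_u⟩ = e^{2πiu/q}|ψ_u⟩) and §2.2] -/
theorem mode_shift {M : ℕ} (hM : 0 < M) (u b : ℕ) {x : ℕ} (hx : x < M) :
    mode M u ((x + M - b % M) % M) = e (((u * b : ℕ) : ℝ) / M) * mode M u x := by
  have hb : b % M < M := Nat.mod_lt _ hM
  have hlt : (x + M - b % M) % M < M := Nat.mod_lt _ hM
  -- the exponents agree modulo `1`
  have hdm := Nat.div_add_mod (x + M - b % M) M
  have hbm := Nat.div_add_mod b M
  set q := (x + M - b % M) / M with hq
  set r := (x + M - b % M) % M with hr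
  set bd := b / M with hbd
  have hMr : (M : ℝ) ≠ 0 := by exact_mod_cast hM.ne'
  have hcast : (M : ℝ) * q + r = x + M - (b % M : ℕ) := by
    have : ((M * q + r : ℕ) : ℝ) = ((x + M - b % M : ℕ) : ℝ) := by exact_mod_cast hdm
    push_cast [Nat.cast_sub (show b % M ≤ x + M by omega)] at this
    linarith
  have hbcast : ((b % M : ℕ) : ℝ) = b - M * bd := by
    have : ((M * bd + b % M : ℕ) : ℝ) = (b : ℝ) := by exact_mod_cast hbm
    push_cast at this; linarith
  have hrr : (r : ℝ) = x + M - (b - M * bd) - M * q := by rw [← hbcast]; linarith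
  rw [mode_of_lt hlt, mode_of_lt hx, mul_left_comm, ← e_add]
  congr 1
  have key : -((u * r : ℕ) : ℝ) / M =
      (((u * b : ℕ) : ℝ) / M + -((u * x : ℕ) : ℝ) / M) + (((u : ℤ) * q - u - u * bd : ℤ) : ℝ) := by
    push_cast
    rw [hrr]
    field_simp
    ring
  rw [key, e_add_intCast]

/-- The eigenvalue: `ψ_u((x + M − 1) mod M) = e(u/M) ψ_u(x)` (the shift `|x⟩ ↦ |x + 1⟩` reads `ψ_u`
one step back). [cite: Kitaev1995, §5] -/
theorem mode_succ {M : ℕ} (hM : 1 < M) (u : ℕ) {x : ℕ} (hx : x < M) :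
    mode M u ((x + M - 1) % M) = e ((u : ℝ) / M) * mode M u x := by
  have h := mode_shift (by omega) u 1 hx
  rwa [Nat.mod_eq_of_lt hM, mul_one] at h

/-! ### Mode coefficients: Fourier inversion on `ℤ_M` -/

/-- **The coefficient of `f` on the mode `u`**: `M^{-1/2} Σ_{z<M} f(z) e(uz/M)` (`= ⟨ψ_u, f⟩` for `f`
supported below `M`). [cite: Kitaev1995, §5] -/
def modeCoeff (M u : ℕ) (f : ℕ → ℂ) : ℂ := (((Real.sqrt M)⁻¹ : ℝ) : ℂ) * ∑ z ∈ range M, f z * e (((u * z : ℕ) : ℝ) / M)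

/-- The coefficient is the inner product with the mode. [folklore] -/
theorem sum_conj_mode_mul {M K : ℕ} (hK : M ≤ K) (u : ℕ) {f : ℕ → ℂ} (hf : ∀ z, M ≤ z → f z = 0) :
    ∑ z ∈ range K, (starRingEnd ℂ) (mode M u z) * f z = modeCoeff M u f := by
  rw [← sum_range_add_sum_Ico _ hK, sum_eq_zero (s := Ico M K) (fun z hz => by rw [hf z (mem_Ico.1 hz).1, mul_zero]),
    add_zero, modeCoeff, mul_sum]
  refine sum_congr rfl fun z hz => ?_
  rw [conj_mode_of_lt (mem_range.1 hz)]; ring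

/-- **Fourier inversion on `ℤ_M`**: `f(x) = Σ_{u<M} modeCoeff_u(f) ψ_u(x)` for `x < M`.
[cite: Kitaev1995, §5] -/
theorem sum_modeCoeff_mul_mode {M : ℕ} (hM : 0 < M) (f : ℕ → ℂ) {x : ℕ} (hx : x < M) :
    ∑ u ∈ range M, modeCoeff M u f * mode M u x = f x := by
  have hMr : (0 : ℝ) < M := by exact_mod_cast hM
  have hs : ((((Real.sqrt M)⁻¹ : ℝ) : ℂ)) * (((Real.sqrt M)⁻¹ : ℝ) : ℂ) = ((M : ℂ))⁻¹ := by
    rw [← Complex.ofReal_mul, ← mul_inv, Real.mul_self_sqrt hMr.le]; push_cast; rfl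
  have hterm : ∀ u ∈ range M, modeCoeff M u f * mode M u x =
      ((M : ℂ))⁻¹ * ∑ z ∈ range M, f z * e ((((z : ℤ) - x : ℤ) : ℝ) * u / M) := by
    intro u _
    rw [modeCoeff, mode_of_lt hx, mul_sum, sum_mul, mul_sum]
    refine sum_congr rfl fun z _ => ?_
    calc (((Real.sqrt M)⁻¹ : ℝ) : ℂ) * (f z * e (((u * z : ℕ) : ℝ) / M)) * ((((Real.sqrt M)⁻¹ : ℝ) : ℂ) * e (-((u * x : ℕ) : ℝ) / M))
        = ((((Real.sqrt M)⁻¹ : ℝ) : ℂ)) * (((Real.sqrt M)⁻¹ : ℝ) : ℂ) * (f z * (e (((u * z : ℕ) : ℝ) / M) * e (-((u * x : ℕ) : ℝ) / M))) := by ring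
      _ = ((M : ℂ))⁻¹ * (f z * e ((((z : ℤ) - x : ℤ) : ℝ) * u / M)) := by
        rw [hs, ← e_add]; congr 3; push_cast; ring
  rw [sum_congr rfl hterm, ← mul_sum, sum_comm]
  have hinner : ∀ z ∈ range M, ∑ u ∈ range M, f z * e ((((z : ℤ) - x : ℤ) : ℝ) * u / M) = if z = x then (M : ℂ) * f z else 0 := by
    intro z hz
    rw [← mul_sum, sum_range_e_mul_div M hM]
    by_cases hzx : z = x
    · subst hzx; rw [if_pos (by simp), if_pos rfl, mul_comm]
    · rw [if_neg, mul_zero, if_neg hzx]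
      intro hd
      have h1 : |((z : ℤ) - x)| < M := by
        have := mem_range.1 hz
        rw [abs_lt]; constructor <;> omega
      have := Int.eq_zero_of_abs_lt_dvd hd h1
      omega
  rw [sum_congr rfl hinner, Finset.sum_eq_single x (fun z _ hz => if_neg hz) (fun h => absurd (mem_range.2 hx) h),
    if_pos rfl, ← mul_assoc, inv_mul_cancel₀ (by exact_mod_cast hM.ne'), one_mul]

/-! ### The repeated basis state -/

/-- **The `R`-fold repetition of `|y⟩` with period `p`** as an amplitude function:
`rep(z) = R^{-1/2}` at `z = y + jp`, `j < R`, `0` elsewhere. [cite: Hales2002, Ch. 5 §1 Algorithm 3 ("repeat |α⟩ R times")] -/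
def rep (p R y z : ℕ) : ℂ := if z % p = y % p ∧ z / p < R ∧ y < p then (((Real.sqrt R)⁻¹ : ℝ) : ℂ) else 0

/-- **The mode coefficients of the repeated state are Hales's transformed repetition**:
`modeCoeff M u (rep p R y) = repFT p R M y u` for `y < p`, `Rp ≤ M`. [cite: Kitaev1995, §5] [cite: Hales2002, Ch. 5 §1 Algorithm 3] -/
theorem modeCoeff_rep_eq_repFT {p R M y : ℕ} (hp : 0 < p) (hy : y < p) (hRM : R * p ≤ M) (u : ℕ) :
    modeCoeff M u (rep p R y) = repFT p R M y u := by
  have hsub : ∀ z, z ∈ range M → rep p R y z ≠ 0 → z ∈ (range R).image (fun j => y + j * p) := by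
    intro z _ hz
    unfold rep at hz
    split_ifs at hz with h
    · obtain ⟨hmod, hdiv, -⟩ := h
      refine mem_image.2 ⟨z / p, mem_range.2 hdiv, ?_⟩
      have := Nat.div_add_mod z p
      rw [Nat.mod_eq_of_lt hy] at hmod
      rw [hmod] at this
      linarith [this, Nat.mul_comm p (z / p)]
    · exact absurd rfl hz
  rw [modeCoeff, repFT]
  -- restrict the sum to the support and reindex by `j`
  rw [← sum_subset (s₁ := (range R).image (fun j => y + j * p)) (fun z hz => by
      obtain ⟨j, hj, rfl⟩ := mem_image.1 hz
      exact mem_range.2 (by have := mem_range.1 hj; nlinarith)) (fun z hz hnot => by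
      by_cases h : rep p R y z = 0
      · rw [h, zero_mul]
      · exact absurd (hsub z hz h) hnot),
    sum_image (fun j _ j' _ h => by simpa [hp.ne'] using h)]
  have hval : ∀ j ∈ range R, rep p R y (y + j * p) = (((Real.sqrt R)⁻¹ : ℝ) : ℂ) := by
    intro j hj
    unfold rep
    rw [if_pos]
    refine ⟨by rw [Nat.add_mul_mod_self_right], ?_, hy⟩
    rw [show (y + j * p) / p = j from by rw [Nat.add_mul_div_right _ _ hp, Nat.div_eq_of_lt hy, zero_add]]
    exact mem_range.1 hj
  rw [sum_congr rfl fun j hj => by rw [hval j hj]]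
  have hRM' : (((Real.sqrt M)⁻¹ : ℝ) : ℂ) * (((Real.sqrt R)⁻¹ : ℝ) : ℂ) = ((((Real.sqrt ((R : ℝ) * M))⁻¹ : ℝ) : ℂ)) := by
    rw [← Complex.ofReal_mul, ← mul_inv, mul_comm, ← Real.sqrt_mul (Nat.cast_nonneg R)]
  rw [mul_sum, mul_sum]
  refine sum_congr rfl fun j _ => ?_
  rw [← mul_assoc, hRM']
  congr 2
  push_cast
  ring

end Kitaev

end Literature.Computability.Cryptography

end
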